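import Summits.ValiantsHypothesis.ValiantsHypothesis.Theorems.FreeSubtorusOrbitDimensionBoundStubPolystableModelLevels
import Summits.ValiantsHypothesis.ValiantsHypothesis.Theorems.FreeSubtorusOrbitDimensionBoundStubStableReductionAtomBlock

/-!
# `OrbitDimensionBound` (stmt-ValiantsHypothesis-16133), rung line `filtered_covering` — stub `stub_polystableModel`,
# part 3: a semisimple pencil is degeneration-closed

Helper file (part 3) for stub 1 `stub_polystableModel` of `Cruxes/OrbitDimensionBound/Lines/filtered_covering.lean`
(route `FreeSubtorus`).  Main result **`truncate_eq_baseChange_of_complemented`**: if every balanced sub-pencil of the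
square polynomial matrix `X` (`det X ≠ 0`) has a balanced complement, then for all weights `a, b` with `X i j = 0` whenever
`a i < b j` and `Σ a = Σ b`, the weight-diagonal part `(X i j · [a i = b j])` — the limit of the one-parameter degeneration
— is a CONSTANT GAUGE FORM `S · X · T` of `X` (`S, T ∈ GL_m(ℂ)`).  Proof: by part 2 (`exists_level_splitting`) the level
sub-pencils split, `ℂ^m = ⊕_w C_w` with `C_w ⊆ V_{≥w}`, `C_w ∩ V_{>w} = 0`; the coordinate projections of `C_w` onto the
level-`w` coordinates glue (along collected bases) to automorphisms `Φ` (source) and `Ψ` (target) with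
`B_e ∘ Φ = Ψ ∘ X_e` for every coefficient matrix.  In King's language: a semisimple object is isomorphic to the associated
graded of any of its filtrations.

Helper mode (`--supports stmt-ValiantsHypothesis-16133 --as helper`).  Honest framing: [folklore] linear algebra toward
ONE registered stub (`stub_polystableModel`, L) of a dormant rung line; the crux `OrbitDimensionBound`, the route
`FreeSubtorus` and VP ≠ VNP are OPEN and are not moved by this file.

## References (orientation only)
* A. D. King, Quart. J. Math. 45 (1994), §2–3.  * G. Kempf, L. Ness (1979).
-/

set_option linter.dupNamespace false

namespace Summit.ValiantsHypothesis.ValiantsHypothesis.Theorems.FreeSubtorusOrbitDimensionBound.SquareCovering.StableReduction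

open Matrix MvPolynomial Module
open Literature.Computability.AlgebraicComplexity
open Summit.ValiantsHypothesis.ValiantsHypothesis.Theorems.FreeSubtorusOrbitDimensionBound.SquareCovering
open Summit.ValiantsHypothesis.ValiantsHypothesis.Theorems.FreeSubtorusOrbitDimensionBound.SignCovering.PerSummand

section Closed

variable {σ : Type*} {m : ℕ}

/-- The weight-diagonal part commutes with taking coefficient matrices. [folklore] -/
theorem truncate_map_coeff (a b : Fin m → ℕ) (X : Matrix (Fin m) (Fin m) (MvPolynomial σ ℂ)) (e : σ →₀ ℕ) :
    (Matrix.of fun i j => if a i = b j then X i j else 0).map (coeff e) =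
      Matrix.of fun i j => if a i = b j then X.map (coeff e) i j else 0 := by
  ext i j
  simp only [Matrix.map_apply, Matrix.of_apply]
  split_ifs <;> simp

/-- The weight-diagonal part, applied to a vector supported on the level `b = w`, is the level-`a = w` part of the
image. [folklore] -/
theorem truncate_mulVec_level (a b : Fin m → ℕ) (Y : Matrix (Fin m) (Fin m) ℂ) (w : ℕ) (u : Fin m → ℂ)
    (hu : ∀ j, b j ≠ w → u j = 0) (i : Fin m) :
    ((Matrix.of fun i j => if a i = b j then Y i j else 0) *ᵥ u) i = if a i = w then (Y *ᵥ u) i else 0 := by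
  simp only [Matrix.mulVec, dotProduct, Matrix.of_apply]
  split_ifs with hi
  · refine Finset.sum_congr rfl fun j _ => ?_
    by_cases hj : b j = w
    · rw [if_pos (hi.trans hj.symm)]
    · rw [hu j hj, mul_zero, mul_zero]
  · refine Finset.sum_eq_zero fun j _ => ?_
    by_cases hj : b j = w
    · rw [if_neg (fun h => hi (h.trans hj)), zero_mul]
    · rw [hu j hj, mul_zero]

/-- **A semisimple pencil is degeneration-closed** (see the module docstring). [folklore] -/
theorem truncate_eq_baseChange_of_complemented (X : Matrix (Fin m) (Fin m) (MvPolynomial σ ℂ)) (hX : X.det ≠ 0)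
    (hcompl : ∀ U : Submodule ℂ (Fin m → ℂ),
      finrank ℂ ↥(⨆ e : σ →₀ ℕ, U.map (Matrix.toLin' (X.map (coeff e)))) ≤ finrank ℂ U →
      ∃ C : Submodule ℂ (Fin m → ℂ), finrank ℂ ↥(⨆ e : σ →₀ ℕ, C.map (Matrix.toLin' (X.map (coeff e)))) ≤ finrank ℂ C ∧
        U ⊓ C = ⊥ ∧ U ⊔ C = ⊤)
    (a b : Fin m → ℕ) (hz : ∀ i j, a i < b j → X i j = 0) (hs : ∑ i, a i = ∑ j, b j) :
    ∃ S T : GL (Fin m) ℂ, (Matrix.of fun i j => if a i = b j then X i j else 0) =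
      (S : Matrix (Fin m) (Fin m) ℂ).map C * X * (T : Matrix (Fin m) (Fin m) ℂ).map C := by
  classical
  set F : (σ →₀ ℕ) → (Fin m → ℂ) →ₗ[ℂ] (Fin m → ℂ) := fun e => Matrix.toLin' (X.map (coeff e)) with hF
  have hss : ∀ V : Submodule ℂ (Fin m → ℂ), finrank ℂ V ≤ finrank ℂ ↥(⨆ e, V.map (F e)) := by
    intro V
    by_contra hlt
    refine hX (det_eq_zero_of_subpencil X V (⨆ e, V.map (F e)) (fun e x hx => ?_) (not_le.1 hlt))
    exact Submodule.mem_iSup_of_mem e (Submodule.mem_map_of_mem hx)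
  obtain ⟨L, hbL⟩ : ∃ L : ℕ, ∀ j, b j ≤ L :=
    ⟨∑ j, b j, fun j => Finset.single_le_sum (fun j _ => Nat.zero_le (b j)) (Finset.mem_univ j)⟩
  obtain ⟨Cw, hCbal, hCsupp, hCinj, hVint, hWint, hDsupp, hDinj⟩ := exists_level_splitting X hX hcompl a b hz hs L hbL
  -- bases and the glued projections
  let bC : ∀ w : Fin (L + 1), Basis (Fin (finrank ℂ (Cw w))) ℂ (Cw w) := fun w => Module.finBasis ℂ _
  let bD : ∀ w : Fin (L + 1), Basis (Fin (finrank ℂ ↥(⨆ e, (Cw w).map (F e)))) ℂ ↥(⨆ e, (Cw w).map (F e)) :=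
    fun w => Module.finBasis ℂ _
  let cV := hVint.collectedBasis bC
  let cW := hWint.collectedBasis bD
  let πb : ℕ → (Fin m → ℂ) →ₗ[ℂ] (Fin m → ℂ) := fun w =>
    Matrix.toLin' (Matrix.diagonal fun j : Fin m => if b j = w then (1 : ℂ) else 0)
  let πa : ℕ → (Fin m → ℂ) →ₗ[ℂ] (Fin m → ℂ) := fun w =>
    Matrix.toLin' (Matrix.diagonal fun i : Fin m => if a i = w then (1 : ℂ) else 0)
  have hπb : ∀ w v j, πb w v j = if b j = w then v j else 0 := fun w v j => by
    simp only [πb, Matrix.toLin'_apply, Matrix.mulVec_diagonal]; split_ifs <;> simp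
  have hπa : ∀ w v i, πa w v i = if a i = w then v i else 0 := fun w v i => by
    simp only [πa, Matrix.toLin'_apply, Matrix.mulVec_diagonal]; split_ifs <;> simp
  let Φ : (Fin m → ℂ) →ₗ[ℂ] (Fin m → ℂ) := cV.constr ℂ fun x => πb x.1 (cV x)
  let Ψ : (Fin m → ℂ) →ₗ[ℂ] (Fin m → ℂ) := cW.constr ℂ fun x => πa x.1 (cW x)
  have hΦ : ∀ (w : Fin (L + 1)) (v : Fin m → ℂ), v ∈ Cw w → Φ v = πb w v := by
    intro w v hv
    have h1 : Φ ∘ₗ (Cw w).subtype = πb w ∘ₗ (Cw w).subtype := (bC w).ext fun k => by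
      simp only [LinearMap.coe_comp, Function.comp_apply, Submodule.coe_subtype]
      rw [show ((bC w k : Cw w) : Fin m → ℂ) = cV ⟨w, k⟩ from (hVint.collectedBasis_coe bC ▸ rfl)]
      exact cV.constr_basis ℂ _ _
    exact congrArg (fun f : ↥(Cw w) →ₗ[ℂ] (Fin m → ℂ) => f ⟨v, hv⟩) h1
  have hΨ : ∀ (w : Fin (L + 1)) (u : Fin m → ℂ), u ∈ (⨆ e, (Cw w).map (F e)) → Ψ u = πa w u := by
    intro w u hu
    have h1 : Ψ ∘ₗ (⨆ e, (Cw w).map (F e)).subtype = πa w ∘ₗ (⨆ e, (Cw w).map (F e)).subtype := (bD w).ext fun k => by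
      simp only [LinearMap.coe_comp, Function.comp_apply, Submodule.coe_subtype]
      rw [show ((bD w k : ↥(⨆ e, (Cw w).map (F e))) : Fin m → ℂ) = cW ⟨w, k⟩ from (hWint.collectedBasis_coe bD ▸ rfl)]
      exact cW.constr_basis ℂ _ _
    exact congrArg (fun f : ↥(⨆ e, (Cw w).map (F e)) →ₗ[ℂ] (Fin m → ℂ) => f ⟨u, hu⟩) h1
  -- the key identity on each `C_w`: `B_e (Φ v) = Ψ (X_e v)`
  have hkey : ∀ (e : σ →₀ ℕ) (w : Fin (L + 1)) (v : Fin m → ℂ), v ∈ Cw w →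
      Matrix.toLin' ((Matrix.of fun i j => if a i = b j then X i j else 0).map (coeff e)) (Φ v) = Ψ (F e v) := by
    intro e w v hv
    rw [hΦ w v hv, hΨ w _ (Submodule.mem_iSup_of_mem e (Submodule.mem_map_of_mem hv)), truncate_map_coeff]
    ext i
    rw [Matrix.toLin'_apply, truncate_mulVec_level a b _ w _ (fun j hj => by rw [hπb, if_neg hj]), hπa]
    split_ifs with hi
    · -- `(X_e (πb v))_i = (X_e v)_i` for `a i = w`: the difference `v - πb v` lives on the levels `b > w`
      change (X.map (coeff e) *ᵥ πb w v) i = (Matrix.toLin' (X.map (coeff e)) v) i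
      simp only [Matrix.toLin'_apply, Matrix.mulVec, dotProduct]
      refine Finset.sum_congr rfl fun j _ => ?_
      rw [hπb]
      split_ifs with hj
      · rfl
      · rcases lt_or_gt_of_ne hj with hlt | hgt
        · rw [hCsupp w v hv j hlt]
        · rw [Matrix.map_apply, hz i j (by omega), coeff_zero, zero_mul, zero_mul]
    · rfl
  have hkey' : ∀ e : σ →₀ ℕ,
      Matrix.toLin' ((Matrix.of fun i j => if a i = b j then X i j else 0).map (coeff e)) ∘ₗ Φ = Ψ ∘ₗ F e := by
    intro e
    refine cV.ext fun x => ?_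
    simp only [LinearMap.coe_comp, Function.comp_apply]
    exact hkey e x.1 (cV x) (hVint.collectedBasis_mem bC x)
  -- `Φ` and `Ψ` are injective
  have hΦinj : Function.Injective Φ := by
    rw [← LinearMap.ker_eq_bot, LinearMap.ker_eq_bot']
    intro v hv
    -- decompose `v` along `⊕ C_w`
    have hdec : v = ∑ w : Fin (L + 1), ∑ k, cV.repr v ⟨w, k⟩ • cV ⟨w, k⟩ := by
      conv_lhs => rw [← cV.sum_repr v]
      rw [Fintype.sum_sigma]
    have hmem : ∀ w : Fin (L + 1), (∑ k, cV.repr v ⟨w, k⟩ • cV ⟨w, k⟩) ∈ Cw w := fun w =>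
      Submodule.sum_mem _ fun k _ => Submodule.smul_mem _ _ (hVint.collectedBasis_mem bC ⟨w, k⟩)
    have hzero : ∀ w : Fin (L + 1), (∑ k, cV.repr v ⟨w, k⟩ • cV ⟨w, k⟩) = 0 := by
      intro w
      refine hCinj w _ (hmem w) fun j hj => ?_
      have h1 := congrFun (show Φ v = 0 from hv) j
      rw [hdec, map_sum] at h1
      simp only [Finset.sum_apply, Pi.zero_apply] at h1
      rw [Finset.sum_eq_single w] at h1
      · rwa [hΦ w _ (hmem w), hπb, if_pos hj] at h1
      · intro w' _ hw'
        rw [hΦ w' _ (hmem w'), hπb, if_neg]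
        intro h; exact hw' (Fin.ext (by rw [← h, hj]))
      · exact fun h => absurd (Finset.mem_univ w) h
    rw [hdec]
    exact Finset.sum_eq_zero fun w _ => hzero w
  have hΨinj : Function.Injective Ψ := by
    rw [← LinearMap.ker_eq_bot, LinearMap.ker_eq_bot']
    intro u hu
    have hdec : u = ∑ w : Fin (L + 1), ∑ k, cW.repr u ⟨w, k⟩ • cW ⟨w, k⟩ := by
      conv_lhs => rw [← cW.sum_repr u]
      rw [Fintype.sum_sigma]
    have hmem : ∀ w : Fin (L + 1), (∑ k, cW.repr u ⟨w, k⟩ • cW ⟨w, k⟩) ∈ ⨆ e, (Cw w).map (F e) := fun w =>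
      Submodule.sum_mem _ fun k _ => Submodule.smul_mem _ _ (hWint.collectedBasis_mem bD ⟨w, k⟩)
    have hzero : ∀ w : Fin (L + 1), (∑ k, cW.repr u ⟨w, k⟩ • cW ⟨w, k⟩) = 0 := by
      intro w
      refine hDinj w _ (hmem w) fun i hi => ?_
      have h1 := congrFun (show Ψ u = 0 from hu) i
      rw [hdec, map_sum] at h1
      simp only [Finset.sum_apply, Pi.zero_apply] at h1
      rw [Finset.sum_eq_single w] at h1
      · rwa [hΨ w _ (hmem w), hπa, if_pos hi] at h1
      · intro w' _ hw'
        rw [hΨ w' _ (hmem w'), hπa, if_neg]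
        intro h; exact hw' (Fin.ext (by rw [← h, hi]))
      · exact fun h => absurd (Finset.mem_univ w) h
    rw [hdec]
    exact Finset.sum_eq_zero fun w _ => hzero w
  -- invertible matrices and the conclusion
  have hΦbij : Function.Bijective Φ := ⟨hΦinj, LinearMap.surjective_of_injective hΦinj⟩
  have hΨbij : Function.Bijective Ψ := ⟨hΨinj, LinearMap.surjective_of_injective hΨinj⟩
  have hΦdet : (LinearMap.toMatrix' Φ).det ≠ 0 := by
    rw [LinearMap.det_toMatrix']
    exact (LinearEquiv.isUnit_det' (LinearEquiv.ofBijective Φ hΦbij)).ne_zero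
  have hΨdet : (LinearMap.toMatrix' Ψ).det ≠ 0 := by
    rw [LinearMap.det_toMatrix']
    exact (LinearEquiv.isUnit_det' (LinearEquiv.ofBijective Ψ hΨbij)).ne_zero
  set S := Matrix.GeneralLinearGroup.mkOfDetNeZero _ hΨdet with hSdef
  set T := Matrix.GeneralLinearGroup.mkOfDetNeZero _ hΦdet with hTdef
  refine ⟨S, T⁻¹, eq_of_forall_map_coeff _ _ fun e => ?_⟩
  rw [map_coeff_mul_map_C, map_coeff_map_C_mul]
  -- `B_e · [Φ] = [Ψ] · X_e`, then multiply by `[Φ]⁻¹`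
  have h1 : (Matrix.of fun i j => if a i = b j then X i j else 0).map (coeff e) * LinearMap.toMatrix' Φ =
      LinearMap.toMatrix' Ψ * X.map (coeff e) := by
    have h2 := hkey' e
    rw [← Matrix.toLin'_toMatrix' Φ, ← Matrix.toLin'_mul] at h2
    rw [← Matrix.toLin'_toMatrix' Ψ, hF] at h2
    simp only at h2
    rw [← Matrix.toLin'_mul] at h2
    exact Matrix.toLin'.injective h2
  have h3 : (T : Matrix (Fin m) (Fin m) ℂ) * ((T⁻¹ : GL (Fin m) ℂ) : Matrix (Fin m) (Fin m) ℂ) = 1 := by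
    rw [← Units.val_mul, mul_inv_cancel, Units.val_one]
  calc (Matrix.of fun i j => if a i = b j then X i j else 0).map (coeff e)
      = (Matrix.of fun i j => if a i = b j then X i j else 0).map (coeff e) *
          ((T : Matrix (Fin m) (Fin m) ℂ) * ((T⁻¹ : GL (Fin m) ℂ) : Matrix (Fin m) (Fin m) ℂ)) := by rw [h3, Matrix.mul_one]
    _ = (S : Matrix (Fin m) (Fin m) ℂ) * X.map (coeff e) * ((T⁻¹ : GL (Fin m) ℂ) : Matrix (Fin m) (Fin m) ℂ) := by
        rw [← Matrix.mul_assoc, hTdef, Matrix.GeneralLinearGroup.val_mkOfDetNeZero, h1, hSdef,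
          Matrix.GeneralLinearGroup.val_mkOfDetNeZero]

end Closed

end Summit.ValiantsHypothesis.ValiantsHypothesis.Theorems.FreeSubtorusOrbitDimensionBound.SquareCovering.StableReduction
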